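import Mathlib

/-!
# T5DoublingBlock — the block identity of (N4.3.P1) and the hyperbolic check in `U(1,1)`

Kernel form of the CLAIM inside (N4.3.P1) of route/T5-N4-p5.md (owner p5), the bounce answer
to ref-2 N-T5N4.1 / ref-4 T5-R4-N4.3-1 (absolute convergence of the archimedean doubling zeta
integral on the half-plane `Re s ≥ 1/2`): for `x = i(g, 1)` in the doubled group, written in
blocks with respect to `W_n = Y_n ⊕ Y_n^∇`, the bottom block row is `(C D) = ((g−1)/2, (g+1)/2)`
and
  `C C* + D D* = ((g−1)(g−1)* + (g+1)(g+1)*)/4 = (1 + g g*)/2`,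
so that `|a(i(g,1))|^{-2} = det((1 + g g*)/2)`; and in the model of one hyperbolic plane
(`U(1,1)` for the form `diag(1, −1)`, `g = a_t = [[cosh t, sinh t],[sinh t, cosh t]]`)
  `det((1 + a_t a_tᵀ)/2) = cosh² t`, i.e. `|a(i(a_t,1))| = 1/cosh t`
— p5's text checks this numerically at `t = 0, 0.5, 1, 2, 4`; here it is an exact identity.

Contents (Mathlib only):
* `star_block_identity` — `(g−1)(g−1)* + (g+1)(g+1)* = 2(1 + g g*)` in any `*`-ring;
* `halves_block_identity` — `C C* + D D* = (1/2)(1 + g g*)` for square complex matrices;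
* `hyperbolic t` — the matrix `a_t`; `hyperbolic_mem_U11` (`a_tᵀ J a_t = J`);
* `half_one_add_hyperbolic_mul_transpose` — `(1/2)(1 + a_t a_tᵀ) = [[cosh² t, sinh t cosh t],
  [sinh t cosh t, cosh² t]]`; `det_half_one_add_hyperbolic` — its determinant is `cosh² t`;
* `one_le_det_half_one_add_hyperbolic`, `det_half_one_add_hyperbolic_eq_one_iff` — `≥ 1`, with
  equality iff `t = 0` (the «equality iff `g ∈ K_W`» clause in the rank-one model);
* `abs_a_hyperbolic` — `det(...)^{-1/2} = 1/cosh t`, and `rpow_neg_le_one_of_one_le` — the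
  dominating bound `|a|^{Re s − 1/2} ≤ 1` for `Re s ≥ 1/2`.
The Cartan-decomposition step of the CLAIM for general `g ∈ U(W)(ℝ)` is not formalised.
-/

namespace Summit.Ventures.HodgeRepro2.T5DoublingBlock

open Matrix Real

/-- **The block identity in any `*`-ring.** `(g−1)(g−1)* + (g+1)(g+1)* = 2(1 + g g*)`. -/
theorem star_block_identity {R : Type*} [Ring R] [StarRing R] (g : R) :
    (g - 1) * star (g - 1) + (g + 1) * star (g + 1) = 2 * (1 + g * star g) := by
  simp only [star_sub, star_add, star_one]
  noncomm_ring

/-- **The halves.** For a square complex matrix `g`, with `C = (g − 1)/2` and `D = (g + 1)/2`: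
`C Cᴴ + D Dᴴ = (1/2)(1 + g gᴴ)`. -/
theorem halves_block_identity {n : Type*} [Fintype n] [DecidableEq n] (g : Matrix n n ℂ) :
    ((1 / 2 : ℂ) • (g - 1)) * ((1 / 2 : ℂ) • (g - 1))ᴴ
        + ((1 / 2 : ℂ) • (g + 1)) * ((1 / 2 : ℂ) • (g + 1))ᴴ
      = (1 / 2 : ℂ) • (1 + g * gᴴ) := by
  have hstar : star (1 / 2 : ℂ) = 1 / 2 := by simp
  have key : (g - 1) * (g - 1)ᴴ + (g + 1) * (g + 1)ᴴ = (1 + g * gᴴ) + (1 + g * gᴴ) := by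
    simp only [Matrix.conjTranspose_sub, Matrix.conjTranspose_add, Matrix.conjTranspose_one]
    noncomm_ring
  simp only [Matrix.conjTranspose_smul, hstar, Matrix.smul_mul, Matrix.mul_smul, smul_smul]
  rw [← smul_add, key, smul_add, ← add_smul]
  norm_num

/-- The hyperbolic element `a_t = [[cosh t, sinh t],[sinh t, cosh t]]` of `U(1,1)` (the form
`diag(1, −1)`), the one-parameter subgroup `A⁺` of the Cartan decomposition in the model of one
hyperbolic plane. -/
noncomputable def hyperbolic (t : ℝ) : Matrix (Fin 2) (Fin 2) ℝ :=
  !![Real.cosh t, Real.sinh t; Real.sinh t, Real.cosh t]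

/-- The hermitian form of signature `(1,1)`: `J = diag(1, −1)`. -/
def J : Matrix (Fin 2) (Fin 2) ℝ := !![1, 0; 0, -1]

/-- `a_t` is symmetric. -/
theorem hyperbolic_transpose (t : ℝ) : (hyperbolic t)ᵀ = hyperbolic t := by
  ext i j
  fin_cases i <;> fin_cases j <;> simp [hyperbolic]

/-- **`a_t ∈ U(1,1)`:** `a_tᵀ J a_t = J`. -/
theorem hyperbolic_mem_U11 (t : ℝ) : (hyperbolic t)ᵀ * J * hyperbolic t = J := by
  rw [hyperbolic_transpose]
  ext i j
  have h := Real.cosh_sq_sub_sinh_sq t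
  fin_cases i <;> fin_cases j <;>
    simp [hyperbolic, J, Matrix.mul_apply, Fin.sum_univ_two] <;> nlinarith [h]

/-- **The matrix `(1/2)(1 + a_t a_tᵀ)`** is `[[cosh² t, sinh t cosh t],[sinh t cosh t, cosh² t]]`. -/
theorem half_one_add_hyperbolic_mul_transpose (t : ℝ) :
    (1 / 2 : ℝ) • (1 + hyperbolic t * (hyperbolic t)ᵀ)
      = !![Real.cosh t ^ 2, Real.sinh t * Real.cosh t;
           Real.sinh t * Real.cosh t, Real.cosh t ^ 2] := by
  rw [hyperbolic_transpose]
  ext i j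
  have h := Real.cosh_sq_sub_sinh_sq t
  fin_cases i <;> fin_cases j <;> simp [hyperbolic] <;> nlinarith [h]

/-- **`det((1 + a_t a_tᵀ)/2) = cosh² t`** — the exact form of p5's numerical check
(`|a(i(a_t,1))| = 1/cosh t` at `t = 0, 0.5, 1, 2, 4`). -/
theorem det_half_one_add_hyperbolic (t : ℝ) :
    ((1 / 2 : ℝ) • (1 + hyperbolic t * (hyperbolic t)ᵀ)).det = Real.cosh t ^ 2 := by
  rw [half_one_add_hyperbolic_mul_transpose, Matrix.det_fin_two_of]
  have h := Real.cosh_sq_sub_sinh_sq t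
  nlinarith [h]

/-- `det((1 + a_t a_tᵀ)/2) ≥ 1`. -/
theorem one_le_det_half_one_add_hyperbolic (t : ℝ) :
    1 ≤ ((1 / 2 : ℝ) • (1 + hyperbolic t * (hyperbolic t)ᵀ)).det := by
  rw [det_half_one_add_hyperbolic]
  have := Real.one_le_cosh t
  nlinarith

/-- `det((1 + a_t a_tᵀ)/2) = 1` iff `t = 0` (iff `a_t = 1 ∈ K_W`). -/
theorem det_half_one_add_hyperbolic_eq_one_iff (t : ℝ) :
    ((1 / 2 : ℝ) • (1 + hyperbolic t * (hyperbolic t)ᵀ)).det = 1 ↔ t = 0 := by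
  rw [det_half_one_add_hyperbolic]
  constructor
  · intro h
    have h1 := Real.one_le_cosh t
    have h2 : Real.sinh t ^ 2 = 0 := by nlinarith [Real.cosh_sq_sub_sinh_sq t]
    have h3 : Real.sinh t = 0 := pow_eq_zero_iff two_ne_zero |>.mp h2
    exact Real.sinh_eq_zero.mp h3
  · rintro rfl
    simp

/-- **`|a(i(a_t,1))| = det(...)^{-1/2} = 1/cosh t`.** -/
theorem abs_a_hyperbolic (t : ℝ) :
    ((1 / 2 : ℝ) • (1 + hyperbolic t * (hyperbolic t)ᵀ)).det ^ (-(1 / 2 : ℝ))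
      = 1 / Real.cosh t := by
  rw [det_half_one_add_hyperbolic]
  have hc : 0 < Real.cosh t := Real.cosh_pos t
  rw [← Real.rpow_natCast, ← Real.rpow_mul hc.le]
  norm_num
  rw [Real.rpow_neg_one]

/-- **The dominating bound.** For `Δ ≥ 1` and `x ≥ 0`: `Δ^{-x} ≤ 1`
(with `Δ = det((1 + g g*)/2)` and `x = (Re s − 1/2)/2`: `|a(i(g,1))|^{Re s − 1/2} ≤ 1` on
`Re s ≥ 1/2`). -/
theorem rpow_neg_le_one_of_one_le {Δ x : ℝ} (hΔ : 1 ≤ Δ) (hx : 0 ≤ x) : Δ ^ (-x) ≤ 1 :=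
  Real.rpow_le_one_of_one_le_of_nonpos hΔ (by linarith)

/-- **The `ε`-neighbourhood bound.** For `Δ ≥ 1` and `0 ≤ y ≤ ε/2`: `Δ^{y} ≤ Δ^{ε/2}`
(with `y = (Re s − 1/2)_-`-type exponents: `|a|^{Re s − 1/2} ≤ Δ^{ε/2}` for `Re s ≥ 1/2 − ε`). -/
theorem rpow_le_rpow_of_one_le {Δ y ε : ℝ} (hΔ : 1 ≤ Δ) (hy : y ≤ ε / 2) : Δ ^ y ≤ Δ ^ (ε / 2) :=
  Real.rpow_le_rpow_of_exponent_le hΔ hy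

/-- In the hyperbolic model, `Δ^{ε/2} = (cosh t)^ε`. -/
theorem det_half_one_add_hyperbolic_rpow (t ε : ℝ) :
    ((1 / 2 : ℝ) • (1 + hyperbolic t * (hyperbolic t)ᵀ)).det ^ (ε / 2) = Real.cosh t ^ ε := by
  rw [det_half_one_add_hyperbolic]
  have hc : 0 < Real.cosh t := Real.cosh_pos t
  rw [← Real.rpow_natCast, ← Real.rpow_mul hc.le]
  congr 1
  push_cast
  ring

end Summit.Ventures.HodgeRepro2.T5DoublingBlock
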